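import Literature.Probability.LatticeModels.GoodCrossingCaseI
import HarnessLib

/-!
# Good crossings in the coexistence case, structured form (contour-free GH2000 L5.5 Case 3)

Topic `Probability/LatticeModels`; theorems only. The estimate `le_measureReal_goodWalk_of_pinning`
(`GoodCrossingCaseI.lean`) remembered only that the good `∗`-walk from `x` to `y` avoids a band.
To combine it with the pinning lemma in Georgii–Higuchi's own form (pinned paths that avoid the box
`Δ` but may pass below it) and with the winding-type enclosure criterion
(`Percolation.upperType_append`, `Percolation.exists_mem_support_of_types`), we re-run the same
proof keeping the *structure* of the walk: `x → a'` (the pinning walk of the second layer, sites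
satisfying `Qx`), `a' → b'` (inside the infinite clusters of the closed upper half-plane: sites
satisfying `PM ⊇ π_up`), `b' ← y` (the pinning walk of the first layer, `Qy`). The pins are allowed
to be two-part (`x → a' → z`, the second part already of type `PM`). Proof: verbatim the proof of
`le_measureReal_goodWalk_of_pinning` (exchangeability + anti-concentration of the last axis site,
FKG for the product, touching criterion).

## References

* H.-O. Georgii, Y. Higuchi, J. Math. Phys. 41 (2000) 1153–1169, Lemma 5.5, proof, Case 3 (p. 15)
  [GeorgiiHiguchi2000].
-/

noncomputable section

open MeasureTheory Filter SimpleGraph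
open Literature.Probability.Percolation
open scoped ENNReal

namespace Literature.Probability.LatticeModels

/-! ### Two-part pinning events -/

section Events

/-- **The two-part `+`pinning event is measurable.** [folklore] -/
theorem measurableSet_plusPin2 (x : Site 2) (Qx PM : Site 2 → Prop) :
    MeasurableSet {ω : SpinConfig (Site 2) | ∃ z, (siteCluster zdStarGraph (spinSites 1 ω ∩ halfPlane 0) z).Infinite ∧
      ∃ a' : Site 2, ∃ P : zdStarGraph.Walk x a', ∃ N : zdStarGraph.Walk a' z,
        (∀ v ∈ P.support, ω v = 1 ∧ Qx v) ∧ (∀ v ∈ N.support, ω v = 1 ∧ PM v)} := by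
  have : {ω : SpinConfig (Site 2) | ∃ z, (siteCluster zdStarGraph (spinSites 1 ω ∩ halfPlane 0) z).Infinite ∧
      ∃ a' : Site 2, ∃ P : zdStarGraph.Walk x a', ∃ N : zdStarGraph.Walk a' z,
        (∀ v ∈ P.support, ω v = 1 ∧ Qx v) ∧ (∀ v ∈ N.support, ω v = 1 ∧ PM v)} =
      ⋃ z, ⋃ a' : Site 2, {ω | (siteCluster zdStarGraph (spinSites 1 ω ∩ halfPlane 0) z).Infinite} ∩
        ({ω | ∃ P : zdStarGraph.Walk x a', ∀ v ∈ P.support, ω v = 1 ∧ Qx v} ∩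
          {ω | ∃ N : zdStarGraph.Walk a' z, ∀ v ∈ N.support, ω v = 1 ∧ PM v}) := by
    ext ω
    simp only [Set.mem_setOf_eq, Set.mem_iUnion, Set.mem_inter_iff]
    constructor
    · rintro ⟨z, hz, a', P, N, hP, hN⟩; exact ⟨z, a', hz, ⟨P, hP⟩, ⟨N, hN⟩⟩
    · rintro ⟨z, a', hz, ⟨P, hP⟩, ⟨N, hN⟩⟩; exact ⟨z, hz, a', P, N, hP, hN⟩
  rw [this]
  exact MeasurableSet.iUnion fun z => MeasurableSet.iUnion fun a' =>
    (measurableSet_infinite_plusStarCluster z).inter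
      ((measurableSet_exists_spinWalk 1 x a' Qx).inter (measurableSet_exists_spinWalk 1 a' z PM))

/-- **The two-part `-`pinning event is measurable.** [folklore] -/
theorem measurableSet_minusPin2 (y : Site 2) (Qy PM : Site 2 → Prop) :
    MeasurableSet {ω : SpinConfig (Site 2) | ∃ z, (siteCluster (zdGraph 2) (spinSites (-1) ω ∩ halfPlane 0) z).Infinite ∧
      ∃ b' : Site 2, ∃ P : zdStarGraph.Walk y b', ∃ N : zdStarGraph.Walk b' z,
        (∀ v ∈ P.support, ω v = -1 ∧ Qy v) ∧ (∀ v ∈ N.support, ω v = -1 ∧ PM v)} := by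
  have : {ω : SpinConfig (Site 2) | ∃ z, (siteCluster (zdGraph 2) (spinSites (-1) ω ∩ halfPlane 0) z).Infinite ∧
      ∃ b' : Site 2, ∃ P : zdStarGraph.Walk y b', ∃ N : zdStarGraph.Walk b' z,
        (∀ v ∈ P.support, ω v = -1 ∧ Qy v) ∧ (∀ v ∈ N.support, ω v = -1 ∧ PM v)} =
      ⋃ z, ⋃ b' : Site 2, {ω | (siteCluster (zdGraph 2) (spinSites (-1) ω ∩ halfPlane 0) z).Infinite} ∩
        ({ω | ∃ P : zdStarGraph.Walk y b', ∀ v ∈ P.support, ω v = -1 ∧ Qy v} ∩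
          {ω | ∃ N : zdStarGraph.Walk b' z, ∀ v ∈ N.support, ω v = -1 ∧ PM v}) := by
    ext ω
    simp only [Set.mem_setOf_eq, Set.mem_iUnion, Set.mem_inter_iff]
    constructor
    · rintro ⟨z, hz, b', P, N, hP, hN⟩; exact ⟨z, b', hz, ⟨P, hP⟩, ⟨N, hN⟩⟩
    · rintro ⟨z, b', hz, ⟨P, hP⟩, ⟨N, hN⟩⟩; exact ⟨z, hz, b', P, N, hP, hN⟩
  rw [this]
  exact MeasurableSet.iUnion fun z => MeasurableSet.iUnion fun b' =>
    (measurableSet_infinite_minusCluster z).inter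
      ((measurableSet_exists_spinWalk (-1) y b' Qy).inter (measurableSet_exists_spinWalk (-1) b' z PM))

/-- The two-part `+`pinning event is increasing. [folklore] -/
theorem plusPin2_mono {x : Site 2} {Qx PM : Site 2 → Prop} {ω ω' : SpinConfig (Site 2)} (h : ω ≤ ω')
    (hω : ∃ z, (siteCluster zdStarGraph (spinSites 1 ω ∩ halfPlane 0) z).Infinite ∧
      ∃ a' : Site 2, ∃ P : zdStarGraph.Walk x a', ∃ N : zdStarGraph.Walk a' z,
        (∀ v ∈ P.support, ω v = 1 ∧ Qx v) ∧ (∀ v ∈ N.support, ω v = 1 ∧ PM v)) :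
    ∃ z, (siteCluster zdStarGraph (spinSites 1 ω' ∩ halfPlane 0) z).Infinite ∧
      ∃ a' : Site 2, ∃ P : zdStarGraph.Walk x a', ∃ N : zdStarGraph.Walk a' z,
        (∀ v ∈ P.support, ω' v = 1 ∧ Qx v) ∧ (∀ v ∈ N.support, ω' v = 1 ∧ PM v) := by
  obtain ⟨z, hinf, a', P, N, hP, hN⟩ := hω
  exact ⟨z, hinf.mono (siteCluster_mono (Set.inter_subset_inter_left _ (spinSites_one_mono h)) _), a', P, N,
    fun v hv => ⟨spinSites_one_mono h (hP v hv).1, (hP v hv).2⟩,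
    fun v hv => ⟨spinSites_one_mono h (hN v hv).1, (hN v hv).2⟩⟩

/-- The two-part `-`pinning event is decreasing. [folklore] -/
theorem minusPin2_anti {y : Site 2} {Qy PM : Site 2 → Prop} {ω ω' : SpinConfig (Site 2)} (h : ω' ≤ ω)
    (hω : ∃ z, (siteCluster (zdGraph 2) (spinSites (-1) ω ∩ halfPlane 0) z).Infinite ∧
      ∃ b' : Site 2, ∃ P : zdStarGraph.Walk y b', ∃ N : zdStarGraph.Walk b' z,
        (∀ v ∈ P.support, ω v = -1 ∧ Qy v) ∧ (∀ v ∈ N.support, ω v = -1 ∧ PM v)) :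
    ∃ z, (siteCluster (zdGraph 2) (spinSites (-1) ω' ∩ halfPlane 0) z).Infinite ∧
      ∃ b' : Site 2, ∃ P : zdStarGraph.Walk y b', ∃ N : zdStarGraph.Walk b' z,
        (∀ v ∈ P.support, ω' v = -1 ∧ Qy v) ∧ (∀ v ∈ N.support, ω' v = -1 ∧ PM v) := by
  have hneg : spinSites (-1) ω ⊆ spinSites (-1) ω' := fun v hv => by
    rw [mem_spinSites] at hv ⊢
    have := h v
    rw [hv] at this
    exact le_antisymm this (neg_one_le_intUnits _)
  obtain ⟨z, hinf, b', P, N, hP, hN⟩ := hω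
  exact ⟨z, hinf.mono (siteCluster_mono (Set.inter_subset_inter_left _ hneg) _), b', P, N,
    fun v hv => ⟨hneg (hP v hv).1, (hP v hv).2⟩, fun v hv => ⟨hneg (hN v hv).1, (hN v hv).2⟩⟩

end Events

/-! ### The structured estimate -/

section Main

variable {β : ℝ} {μ : Measure (SpinConfig (Site 2))}

/-- **Case 3 of Lemma 5.5, contour-free, structured form**: as `le_measureReal_goodWalk_of_pinning`,
with two-part pins and a conclusion remembering the three pieces `x → a'` (sites `Qx`),
`a' → b'` (sites `PM ⊇ π_up`), `b' ← y` (sites `Qy`) of the good `∗`-walk. [cite: GeorgiiHiguchi2000, Lemma 5.5 (proof, Case 3)] -/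
theorem le_measureReal_goodTriple_of_pinning (hβc : criticalBeta 2 < β) (hμ : μ ∈ isingGibbsMeasures 2 β 0)
    (hμt : IsTailTrivial μ) (s : ℤˣ)
    (hL : ∀ᵐ ω ∂μ, ∃ x, ∀ n : ℕ, ∃ k : ℤ, k < -(n : ℤ) ∧
      (![k, 0] : Site 2) ∈ siteCluster zdStarGraph (spinSites 1 ω ∩ halfPlane 0) x)
    (hC : ∀ᵐ ω ∂μ, ∃ y, (siteCluster (zdGraph 2) (spinSites (-1) ω ∩ halfPlane 0) y).Infinite)
    {Qx PM Qy : Site 2 → Prop} (hPM : ∀ v : Site 2, 0 ≤ v 1 → PM v) (x y : Site 2) {cP : ℝ}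
    (hpinx : cP ≤ (μ.map (configShift (Pi.single 0 (s : ℤ)))).real
      {ω : SpinConfig (Site 2) | ∃ z, (siteCluster zdStarGraph (spinSites 1 ω ∩ halfPlane 0) z).Infinite ∧
        ∃ a' : Site 2, ∃ P : zdStarGraph.Walk x a', ∃ N : zdStarGraph.Walk a' z,
          (∀ v ∈ P.support, ω v = 1 ∧ Qx v) ∧ (∀ v ∈ N.support, ω v = 1 ∧ PM v)})
    (hpiny : cP ≤ μ.real
      {ω : SpinConfig (Site 2) | ∃ z, (siteCluster (zdGraph 2) (spinSites (-1) ω ∩ halfPlane 0) z).Infinite ∧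
        ∃ b' : Site 2, ∃ P : zdStarGraph.Walk y b', ∃ N : zdStarGraph.Walk b' z,
          (∀ v ∈ P.support, ω v = -1 ∧ Qy v) ∧ (∀ v ∈ N.support, ω v = -1 ∧ PM v)})
    (hcP : 0 ≤ cP) :
    ((1 - (1 + ENNReal.ofReal (Real.exp (-(8 * |β|)) / 2))⁻¹) / 2).toReal * cP * cP ≤
      (μ.prod (μ.map (configShift (Pi.single 0 (s : ℤ))))).real
        {p : SpinConfig (Site 2) × SpinConfig (Site 2) | ∃ a' b' : Site 2, ∃ Px : zdStarGraph.Walk x a',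
          ∃ M : zdStarGraph.Walk a' b', ∃ Py : zdStarGraph.Walk y b',
            (∀ v ∈ Px.support, p.1 v ≤ p.2 v ∧ Qx v) ∧ (∀ v ∈ M.support, p.1 v ≤ p.2 v ∧ PM v) ∧
              (∀ v ∈ Py.support, p.1 v ≤ p.2 v ∧ Qy v)} := by
  classical
  have hβ : 0 ≤ β := (criticalBeta_nonneg 2).trans hβc.le
  have hμG : IsGibbsMeasure (isingSpecification (zdGraph 2) β 0) μ := hμ
  haveI := hμG.isProbabilityMeasure
  set T : SpinConfig (Site 2) → SpinConfig (Site 2) := ⇑(configShift (S := ℤˣ) (Pi.single (0 : Fin 2) (s : ℤ))) with hT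
  set μ' : Measure (SpinConfig (Site 2)) := μ.map T with hμ'
  have hμ'G : μ' ∈ isingGibbsMeasures 2 β 0 := mem_isingGibbsMeasures_map_configShift hμ _
  have hμ'GG : IsGibbsMeasure (isingSpecification (zdGraph 2) β 0) μ' := hμ'G
  haveI : IsProbabilityMeasure μ' := hμ'GG.isProbabilityMeasure
  have hμ't : IsTailTrivial μ' := hμt.map_configRelabel (Site.shift _)
  -- the events
  set R : ℤ → Set (SpinConfig (Site 2)) := fun j =>
    {ω : SpinConfig (Site 2) | ∃ k : ℤ, j ≤ k ∧ (siteCluster zdStarGraph (spinSites 1 ω ∩ halfPlane 0) ![k, 0]).Infinite} with hR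
  set Cmp := {p : SpinConfig (Site 2) × SpinConfig (Site 2) | ∃ j : ℤ, p.1 ∉ R (j + 1) ∧ p.2 ∈ R j} with hCmp
  set Px := {ω : SpinConfig (Site 2) | ∃ z, (siteCluster zdStarGraph (spinSites 1 ω ∩ halfPlane 0) z).Infinite ∧
    ∃ a' : Site 2, ∃ P : zdStarGraph.Walk x a', ∃ N : zdStarGraph.Walk a' z,
      (∀ v ∈ P.support, ω v = 1 ∧ Qx v) ∧ (∀ v ∈ N.support, ω v = 1 ∧ PM v)} with hPx
  set Py := {ω : SpinConfig (Site 2) | ∃ z, (siteCluster (zdGraph 2) (spinSites (-1) ω ∩ halfPlane 0) z).Infinite ∧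
    ∃ b' : Site 2, ∃ P : zdStarGraph.Walk y b', ∃ N : zdStarGraph.Walk b' z,
      (∀ v ∈ P.support, ω v = -1 ∧ Qy v) ∧ (∀ v ∈ N.support, ω v = -1 ∧ PM v)} with hPy
  set U := {p : SpinConfig (Site 2) × SpinConfig (Site 2) | ∃ a' b' : Site 2, ∃ Px : zdStarGraph.Walk x a',
    ∃ M : zdStarGraph.Walk a' b', ∃ Py : zdStarGraph.Walk y b',
      (∀ v ∈ Px.support, p.1 v ≤ p.2 v ∧ Qx v) ∧ (∀ v ∈ M.support, p.1 v ≤ p.2 v ∧ PM v) ∧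
        (∀ v ∈ Py.support, p.1 v ≤ p.2 v ∧ Qy v)} with hU
  have hCmpm : MeasurableSet Cmp := by
    have : Cmp = ⋃ j : ℤ, (R (j + 1))ᶜ ×ˢ R j := by ext p; simp [hCmp, Set.mem_prod]
    rw [this]
    exact MeasurableSet.iUnion fun j => (measurableSet_axisReach (j + 1)).compl.prod (measurableSet_axisReach j)
  have hPxm : MeasurableSet Px := measurableSet_plusPin2 x Qx PM
  have hPym : MeasurableSet Py := measurableSet_minusPin2 y Qy PM
  -- (1) the comparison event has probability `≥ c₀`
  have hexists : ∀ᵐ ω ∂μ, ∃ j : ℤ, ω ∈ R j \ R (j + 1) := by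
    filter_upwards [ae_exists_lastAxisSite hβc hμ, hL, hC] with ω h hLω hCω
    exact h hLω hCω
  have h1 : (1 - (1 + ENNReal.ofReal (Real.exp (-(8 * |β|)) / 2))⁻¹) / 2 ≤ (μ.prod μ') Cmp :=
    le_measure_axisReach_shift hμ hexists s
  -- (2) positive correlations: `ν(Cmp ∩ (Py × Px)) ≥ ν(Cmp) μ(Py) μ'(Px)`
  have hCmp_mono : ∀ p q : SpinConfig (Site 2) × SpinConfig (Site 2), q.1 ≤ p.1 → p.2 ≤ q.2 → p ∈ Cmp → q ∈ Cmp := by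
    rintro p q h1 h2 ⟨j, hp1, hp2⟩
    exact ⟨j, fun hq => hp1 (axisReach_mono_config h1 hq), axisReach_mono_config h2 hp2⟩
  set PxPair := {p : SpinConfig (Site 2) × SpinConfig (Site 2) | p.2 ∈ Px} with hPxPair
  set PyPair := {p : SpinConfig (Site 2) × SpinConfig (Site 2) | p.1 ∈ Py} with hPyPair
  have hPxPairm : MeasurableSet PxPair := measurable_snd hPxm
  have hPyPairm : MeasurableSet PyPair := measurable_fst hPym
  have hPx_mono : ∀ p q : SpinConfig (Site 2) × SpinConfig (Site 2), q.1 ≤ p.1 → p.2 ≤ q.2 → p ∈ PxPair → q ∈ PxPair :=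
    fun p q _ h2 hp => plusPin2_mono h2 hp
  have hPy_mono : ∀ p q : SpinConfig (Site 2) × SpinConfig (Site 2), q.1 ≤ p.1 → p.2 ≤ q.2 → p ∈ PyPair → q ∈ PyPair :=
    fun p q h1 _ hp => minusPin2_anti h1 hp
  have hfkg1 := prod_measureReal_inter_ge_of_antitone_monotone hβ hβ hμ hμt hμ'G hμ't hCmpm hPxPairm hCmp_mono hPx_mono
  have hfkg2 := prod_measureReal_inter_ge_of_antitone_monotone hβ hβ hμ hμt hμ'G hμ't (hCmpm.inter hPxPairm) hPyPairm
    (fun p q h1 h2 hp => ⟨hCmp_mono p q h1 h2 hp.1, hPx_mono p q h1 h2 hp.2⟩) hPy_mono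
  have hmargx : (μ.prod μ').real PxPair = μ'.real Px := by
    rw [hPxPair, measureReal_def, measureReal_def,
      show {p : SpinConfig (Site 2) × SpinConfig (Site 2) | p.2 ∈ Px} = Set.univ ×ˢ Px by ext p; simp [Set.mem_prod],
      Measure.prod_prod, measure_univ, one_mul]
  have hmargy : (μ.prod μ').real PyPair = μ.real Py := by
    rw [hPyPair, measureReal_def, measureReal_def,
      show {p : SpinConfig (Site 2) × SpinConfig (Site 2) | p.1 ∈ Py} = Py ×ˢ Set.univ by ext p; simp [Set.mem_prod],
      Measure.prod_prod, measure_univ, mul_one]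
  -- (3) the almost-sure inclusion
  have key1 : ∀ᵐ ω ∂μ, ((∃ j : ℤ, ω ∈ R j \ R (j + 1)) ∧
      (∃ yC, (siteCluster (zdGraph 2) (spinSites (-1) ω ∩ halfPlane 0) yC).Infinite) ∧
      (∃ x₀, ∀ n : ℕ, ∃ k : ℤ, k < -(n : ℤ) ∧ (![k, 0] : Site 2) ∈ siteCluster zdStarGraph (spinSites 1 ω ∩ halfPlane 0) x₀)) ∧
      ((∀ x₀ y₁ y₂, (siteCluster zdStarGraph (spinSites 1 ω ∩ halfPlane 0) x₀).Infinite →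
          (siteCluster (zdGraph 2) (spinSites (-1) ω ∩ halfPlane 0) y₁).Infinite →
          (siteCluster (zdGraph 2) (spinSites (-1) ω ∩ halfPlane 0) y₂).Infinite →
          siteCluster (zdGraph 2) (spinSites (-1) ω ∩ halfPlane 0) y₁ = siteCluster (zdGraph 2) (spinSites (-1) ω ∩ halfPlane 0) y₂) ∧
        (∀ x₁ x₂ y₀, (siteCluster zdStarGraph (spinSites 1 ω ∩ halfPlane 0) x₁).Infinite →
          (siteCluster zdStarGraph (spinSites 1 ω ∩ halfPlane 0) x₂).Infinite →
          (siteCluster (zdGraph 2) (spinSites (-1) ω ∩ halfPlane 0) y₀).Infinite →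
          siteCluster zdStarGraph (spinSites 1 ω ∩ halfPlane 0) x₁ = siteCluster zdStarGraph (spinSites 1 ω ∩ halfPlane 0) x₂) ∧
        (∀ x₀ y₀, (siteCluster zdStarGraph (spinSites 1 ω ∩ halfPlane 0) x₀).Infinite →
          (siteCluster (zdGraph 2) (spinSites (-1) ω ∩ halfPlane 0) y₀).Infinite →
          (∀ a k : ℤ, (![a, 0] : Site 2) ∈ siteCluster zdStarGraph (spinSites 1 ω ∩ halfPlane 0) x₀ →
              (![k, 0] : Site 2) ∈ siteCluster (zdGraph 2) (spinSites (-1) ω ∩ halfPlane 0) y₀ → a < k) ∨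
            (∀ a k : ℤ, (![a, 0] : Site 2) ∈ siteCluster zdStarGraph (spinSites 1 ω ∩ halfPlane 0) x₀ →
              (![k, 0] : Site 2) ∈ siteCluster (zdGraph 2) (spinSites (-1) ω ∩ halfPlane 0) y₀ → k < a)) ∧
        (∀ y₀, (siteCluster (zdGraph 2) (spinSites (-1) ω ∩ halfPlane 0) y₀).Infinite →
          ∀ n : ℕ, ∃ z ∈ siteCluster (zdGraph 2) (spinSites (-1) ω ∩ halfPlane 0) y₀, z 1 = 0 ∧ (n : ℤ) < |z 0|)) := by
    filter_upwards [hexists, hC, hL, ae_minus_cluster_unique hβc hμ, ae_plusStar_cluster_unique hβc hμ,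
      ae_plusStar_minus_sides hβc hμ, ae_minus_touches_axis_io (G := zdGraph 2) hβc le_rfl zdGraph_le_zdStarGraph hμ]
      with ω h1 h2 h3 h4 h5 h6 h7
    exact ⟨⟨h1, h2, h3⟩, h4, h5, h6, h7⟩
  have hae1 := (Measure.quasiMeasurePreserving_fst (μ := μ) (ν := μ')).ae key1
  have key2 : ∀ᵐ ω ∂μ', (∀ x₁ x₂ y₀, (siteCluster zdStarGraph (spinSites 1 ω ∩ halfPlane 0) x₁).Infinite →
        (siteCluster zdStarGraph (spinSites 1 ω ∩ halfPlane 0) x₂).Infinite →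
        (siteCluster (zdGraph 2) (spinSites (-1) ω ∩ halfPlane 0) y₀).Infinite →
        siteCluster zdStarGraph (spinSites 1 ω ∩ halfPlane 0) x₁ = siteCluster zdStarGraph (spinSites 1 ω ∩ halfPlane 0) x₂) ∧
      (∃ yC, (siteCluster (zdGraph 2) (spinSites (-1) ω ∩ halfPlane 0) yC).Infinite) := by
    filter_upwards [ae_plusStar_cluster_unique hβc hμ'G, ae_exists_infinite_minusCluster_map_configShift (μ := μ) (s : ℤ) hC]
      with ω h1 h2
    exact ⟨h1, h2⟩
  have hae2 := (Measure.quasiMeasurePreserving_snd (μ := μ) (ν := μ')).ae key2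
  have hincl : ∀ᵐ p ∂(μ.prod μ'), p ∈ Cmp ∩ PxPair ∩ PyPair → p ∈ U := by
    filter_upwards [hae1, hae2] with p h1 h2 hp
    obtain ⟨⟨⟨j₀, hj₀, hj₀'⟩, ⟨yC, hyC⟩, ⟨x₀, hLω⟩⟩, huniqC, huniqD, hsides, htouchC⟩ := h1
    obtain ⟨huniqD', ⟨yC', hyC'⟩⟩ := h2
    obtain ⟨⟨⟨j, hp1, hp2⟩, hpx⟩, hpy⟩ := hp
    set ω := p.1 with hω
    set ω' := p.2 with hω'
    -- the last axis site `a` of the first layer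
    obtain ⟨a, hja, hDinf⟩ := hj₀
    have hamax : ∀ k : ℤ, (siteCluster zdStarGraph (spinSites 1 ω ∩ halfPlane 0) ![k, 0]).Infinite → k ≤ a := by
      intro k hk
      by_contra hlt
      exact hj₀' ⟨k, by omega, hk⟩
    -- the first layer's `+∗`cluster `D` through `(a, 0)`
    have haD : (![a, 0] : Site 2) ∈ siteCluster zdStarGraph (spinSites 1 ω ∩ halfPlane 0) ![a, 0] :=
      (mem_siteCluster_self_iff _ _ _).2 hDinf.nonempty.some_mem.1
    have hmax : ∀ k : ℤ, (![k, 0] : Site 2) ∈ siteCluster zdStarGraph (spinSites 1 ω ∩ halfPlane 0) ![a, 0] → k ≤ a := by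
      intro k hk
      refine hamax k ?_
      rw [siteCluster_eq_of_mem ((mem_siteCluster_self_iff _ _ _).2 hk.2.1) hk]; exact hDinf
    -- `D` touches on the left: it is the cluster of `x₀`
    have hx₀inf := infinite_of_axis_unbounded_below hLω
    have hDx₀ : siteCluster zdStarGraph (spinSites 1 ω ∩ halfPlane 0) x₀ = siteCluster zdStarGraph (spinSites 1 ω ∩ halfPlane 0) ![a, 0] :=
      huniqD x₀ _ yC hx₀inf hDinf hyC
    have hside : ∀ y₀, (siteCluster (zdGraph 2) (spinSites (-1) ω ∩ halfPlane 0) y₀).Infinite →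
        ∀ b k : ℤ, (![b, 0] : Site 2) ∈ siteCluster zdStarGraph (spinSites 1 ω ∩ halfPlane 0) ![a, 0] →
          (![k, 0] : Site 2) ∈ siteCluster (zdGraph 2) (spinSites (-1) ω ∩ halfPlane 0) y₀ → b < k := by
      intro y₀ hy₀
      rcases hsides (![a, 0]) y₀ hDinf hy₀ with h | h
      · exact h
      · exfalso
        obtain ⟨zk, hzk, hzk1, -⟩ := htouchC y₀ hy₀ 0
        have hk : (![zk 0, 0] : Site 2) ∈ siteCluster (zdGraph 2) (spinSites (-1) ω ∩ halfPlane 0) y₀ := by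
          rw [← eq_axis_of_apply_one hzk1]; exact hzk
        obtain ⟨b, hb, hbD⟩ := hLω (zk 0).natAbs
        rw [hDx₀] at hbD
        have := h b (zk 0) hbD hk
        omega
    -- the second layer's cluster through `(k', 0)`, `k' ≥ j ≥ a`
    obtain ⟨k', hjk', hinf'⟩ := hp2
    have hak' : a ≤ k' := by
      have : ¬ (j + 1 ≤ a) := fun h => hp1 ⟨a, h, hDinf⟩
      omega
    have ha'D' : (![k', 0] : Site 2) ∈ siteCluster zdStarGraph (spinSites 1 ω' ∩ halfPlane 0) ![k', 0] :=
      (mem_siteCluster_self_iff _ _ _).2 hinf'.nonempty.some_mem.1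
    obtain ⟨z, hz, z', hz', hzz'⟩ := touch_of_le_maxAxis hDinf haD hmax hside htouchC hinf' ha'D' hak'
    -- the pinning walks
    obtain ⟨z₁, hinf₁, a₁, P₁, N₁, hP₁, hN₁⟩ := hpx
    obtain ⟨z₂, hinf₂, a₂, P₂, N₂, hP₂, hN₂⟩ := hpy
    set C := siteCluster (zdGraph 2) (spinSites (-1) ω ∩ halfPlane 0) ![a + 1, 0] with hCdef
    have hCinf : C.Infinite := infinite_minusCluster_succ_of_isMaxAxis hDinf haD hmax
    -- identify the clusters reached by the pinning walks
    have hz₁self : z₁ ∈ siteCluster zdStarGraph (spinSites 1 ω' ∩ halfPlane 0) z₁ :=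
      (mem_siteCluster_self_iff _ _ _).2 hinf₁.nonempty.some_mem.1
    have hz₂self : z₂ ∈ siteCluster (zdGraph 2) (spinSites (-1) ω ∩ halfPlane 0) z₂ :=
      (mem_siteCluster_self_iff _ _ _).2 hinf₂.nonempty.some_mem.1
    have hD'eq : siteCluster zdStarGraph (spinSites 1 ω' ∩ halfPlane 0) z₁ = siteCluster zdStarGraph (spinSites 1 ω' ∩ halfPlane 0) ![k', 0] :=
      huniqD' z₁ _ yC' hinf₁ hinf' hyC'
    have hCeq : siteCluster (zdGraph 2) (spinSites (-1) ω ∩ halfPlane 0) z₂ = C := huniqC (![a, 0]) z₂ _ hDinf hinf₂ hCinf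
    have hz1 : z ∈ siteCluster zdStarGraph (spinSites 1 ω' ∩ halfPlane 0) z₁ := by rw [hD'eq]; exact hz
    have hz'2 : z' ∈ siteCluster (zdGraph 2) (spinSites (-1) ω ∩ halfPlane 0) z₂ := by rw [hCeq]; exact hz'
    obtain ⟨q₁, hq₁⟩ := exists_walk_of_mem_siteCluster hz₁self hz1
    obtain ⟨q₂, hq₂⟩ := exists_walk_of_mem_siteCluster hz'2 hz₂self
    -- the bridge between `z` and `z'`
    have hbridge : ∃ b : zdStarGraph.Walk z z', ∀ v ∈ b.support, v = z ∨ v = z' := by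
      rcases hzz' with rfl | hadj
      · exact ⟨Walk.nil, fun v hv => by simp at hv; exact Or.inl hv⟩
      · exact ⟨Walk.cons (zdGraph_le_zdStarGraph hadj) Walk.nil, fun v hv => by simpa using hv⟩
    obtain ⟨b, hb⟩ := hbridge
    -- goodness of the various sites
    have hgood_plus : ∀ v, ω' v = 1 → ω v ≤ ω' v := fun v hv => by rw [hv]; exact intUnits_le_one _
    have hgood_minus : ∀ v, ω v = -1 → ω v ≤ ω' v := fun v hv => by rw [hv]; exact neg_one_le_intUnits _
    refine ⟨a₁, a₂, P₁, N₁.append (q₁.append (b.append ((q₂.mapLe zdGraph_le_zdStarGraph).append N₂.reverse))), P₂,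
      fun v hv => ⟨hgood_plus v (hP₁ v hv).1, (hP₁ v hv).2⟩, fun v hv => ?_,
      fun v hv => ⟨hgood_minus v (hP₂ v hv).1, (hP₂ v hv).2⟩⟩
    rw [Walk.mem_support_append_iff, Walk.mem_support_append_iff, Walk.mem_support_append_iff,
      Walk.mem_support_append_iff, Walk.support_mapLe_eq_support, Walk.support_reverse, List.mem_reverse] at hv
    rcases hv with hv | hv | hv | hv | hv
    · exact ⟨hgood_plus v (hN₁ v hv).1, (hN₁ v hv).2⟩
    · have h := hq₁ v hv
      exact ⟨hgood_plus v h.1, hPM v h.2⟩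
    · rcases hb v hv with rfl | rfl
      · exact ⟨hgood_plus _ hz.2.1.1, hPM _ hz.2.1.2⟩
      · exact ⟨hgood_minus _ hz'.2.1.1, hPM _ hz'.2.1.2⟩
    · have h := hq₂ v hv
      exact ⟨hgood_minus v h.1, hPM v h.2⟩
    · exact ⟨hgood_minus v (hN₂ v hv).1, (hN₂ v hv).2⟩
  -- (4) combine
  have hmono : (μ.prod μ').real (Cmp ∩ PxPair ∩ PyPair) ≤ (μ.prod μ').real U := by
    rw [measureReal_def, measureReal_def]
    exact ENNReal.toReal_mono (measure_ne_top _ _) (measure_mono_ae hincl)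
  have hc₀ : ((1 - (1 + ENNReal.ofReal (Real.exp (-(8 * |β|)) / 2))⁻¹) / 2).toReal ≤ (μ.prod μ').real Cmp := by
    rw [measureReal_def]
    exact ENNReal.toReal_mono (measure_ne_top _ _) h1
  have hc₀0 : 0 ≤ ((1 - (1 + ENNReal.ofReal (Real.exp (-(8 * |β|)) / 2))⁻¹) / 2).toReal := ENNReal.toReal_nonneg
  rw [hmargx] at hfkg1
  rw [hmargy] at hfkg2
  calc ((1 - (1 + ENNReal.ofReal (Real.exp (-(8 * |β|)) / 2))⁻¹) / 2).toReal * cP * cP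
      ≤ (μ.prod μ').real Cmp * μ'.real Px * μ.real Py :=
        mul_le_mul (mul_le_mul hc₀ hpinx hcP measureReal_nonneg) hpiny hcP (mul_nonneg measureReal_nonneg measureReal_nonneg)
    _ ≤ (μ.prod μ').real (Cmp ∩ PxPair) * μ.real Py := mul_le_mul_of_nonneg_right hfkg1 measureReal_nonneg
    _ ≤ (μ.prod μ').real (Cmp ∩ PxPair ∩ PyPair) := hfkg2
    _ ≤ (μ.prod μ').real U := hmono

end Main

end Literature.Probability.LatticeModels
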